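import Literature.AlgebraicGeometry.Motives.HodgeLieWeightOnePlusLineIdeal
import Mathlib.Algebra.Lie.Killing
import HarnessLib

/-!
# Weight one, type-III position: the adapted basis `(E, F, Θ, k₁, …, k_m)` of `𝔥_ℂ` and the Killing column of `E`

Family `hodge`, layer `Literature/AlgebraicGeometry/Motives`; THEOREMS ONLY (no definition, no named fact; D-0026).
Sequel of `HodgeLieWeightOnePlusLineIdeal` for the cell `pub-hodgecm2` (COR-CM) lane MT-RANK-SEVEN-TYPEIII, seat `b27`.

SETTING (the type-III position): `H` polarizable of weight `1` on `V`, graded basis `e`, `P` the Hodge projector, a rational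
`X ∈ Lie Hg ∖ End_Hdg` with blocks `E`, `F`, the plus-line hypotheses, `𝔷 = 0`; `𝔤 = 𝔥_ℂ = ℂE ⊕ ℂF ⊕ ℂΘ ⊕ 𝔨`
(`E F = αP`, `F E = α(1 − P)`).  For any Lie subalgebra `𝔏' ≤ 𝔤𝔩_ℂ(V_ℂ)` (commutator bracket) with carrier `𝔥_ℂ`:

* **`exists_basis_plusLine_of_basis`** / `exists_basis_plusLine` — a basis `bk` of `𝔨` (resp. some basis) extends to a basis
  of `𝔏'` indexed by `Fin 3 ⊕ Fin m` with first vectors `E`, `F`, `Θ = 2P − 1`.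
* **`finrank_mul_killingForm_projE`** — **`dim_ℚ V · κ_{𝔏'}(Y, E) = 8 · tr_{V_ℂ}(Y E)` for all `Y ∈ 𝔏'`**: in the adapted basis
  the ad-trace `κ(Y, E) = Σᵢ [⁅Y, ⁅E, bᵢ⁆⁆]ᵢ` has only the contributions `⁅E, F⁆ = αΘ`, `⁅E, Θ⁆ = −2E`, so
  `κ(F, E) = 4α`, `κ(E, E) = κ(Θ, E) = κ(k, E) = 0`, while `8 tr(F E) = 8α · dim V / 2` and `tr(E E) = tr(Θ E) = tr(k E) = 0`
  (trace table of `HodgeLieWeightOnePlusLineBlocks`).  This is the input of the rational-invariant-form argument of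
  `HodgeLieWeightOnePlusLineKilling`.

## References

* [MoonenZarhin1999LowDim] B. Moonen, Yu. Zarhin, *Hodge classes on abelian varieties of low dimension*, Math. Ann. 315
  (1999), §2 (2.3) Type III.
* [Deligne1982HodgeCycles] P. Deligne, *Hodge cycles on abelian varieties*, LNM 900 (1982), I §3 (3.4–3.6).
* [Humphreys1972] J. E. Humphreys, GTM 9 (1972), §5.1 (Killing form), §8.1.
-/

noncomputable section

open scoped TensorProduct

namespace Literature.AlgebraicGeometry.Motives

universe u

namespace HodgeStructure

open ProjectorBlocks Literature.RepresentationTheory.GeneralLinear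

variable {V : Type u} [AddCommGroup V] [Module ℚ V] [Module.Finite ℚ V] [HodgeTensorFacts.{u, u}] {n : ℤ}
  {S : Type u} [Fintype S] [DecidableEq S] {deg : S → ℤ}

/-! ## §1 The adapted basis `(E, F, Θ, k₁, …, k_m)` of `𝔥_ℂ` -/

/-- **An adapted basis of `𝔥_ℂ` in the plus-line position**: for every Lie subalgebra `𝔏' ≤ 𝔤𝔩_ℂ(V_ℂ)` with carrier `𝔥_ℂ`
a basis `bk` of `𝔨 = {K ∈ 𝔥_ℂ : KP = PK, KE = EK}` extends to the basis `(E, F, Θ, bk)` of `𝔏'` indexed by `Fin 3 ⊕ Fin m`. [cite: MoonenZarhin1999LowDim, §2 (2.3)]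
[cite: Deligne1982HodgeCycles, I §3 (proof of Prop. 3.4)] -/
theorem exists_basis_plusLine_of_basis (H : HodgeStructure V n) (hn : n = 1)
    (e : Module.Basis S ℂ (ℂ ⊗[ℚ] V)) (hF : ∀ a, H.F a = Submodule.span ℂ (e '' {σ | a ≤ deg σ}))
    (hFc : ∀ a, complexConj (H.F a) = Submodule.span ℂ (e '' {σ | deg σ ≤ n - a}))
    (hdeg : ∀ σ, deg σ = 0 ∨ deg σ = 1) {X : Module.End ℚ V} (hX : X ∈ H.hodgeLie) (hXE : X ∉ H.endAlg)
    (hplus : ∀ Y ∈ H.hodgeLieC, ∃ c : ℂ,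
      gradingEnd e deg * Y * (1 - gradingEnd e deg) = c • (gradingEnd e deg * X.baseChange ℂ * (1 - gradingEnd e deg)))
    (hminus : ∀ Y ∈ H.hodgeLieC, ∃ c : ℂ,
      (1 - gradingEnd e deg) * Y * gradingEnd e deg = c • ((1 - gradingEnd e deg) * X.baseChange ℂ * gradingEnd e deg)) :
    letI : LieRing (Module.End ℂ (ℂ ⊗[ℚ] V)) := LieRing.ofAssociativeRing
    ∀ (𝔏' : LieSubalgebra ℂ (Module.End ℂ (ℂ ⊗[ℚ] V))), 𝔏'.toSubmodule = H.hodgeLieC → ∀ {m : ℕ}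
      (bk : Module.Basis (Fin m) ℂ (H.hodgeLieC ⊓
        Module.End.eigenspace (LinearMap.mulLeft ℂ (gradingEnd e deg) - LinearMap.mulRight ℂ (gradingEnd e deg)) 0 ⊓
        Module.End.eigenspace (LinearMap.mulLeft ℂ (gradingEnd e deg * X.baseChange ℂ * (1 - gradingEnd e deg)) -
          LinearMap.mulRight ℂ (gradingEnd e deg * X.baseChange ℂ * (1 - gradingEnd e deg))) 0 : Submodule ℂ _)),
      ∃ b : Module.Basis (Fin 3 ⊕ Fin m) ℂ 𝔏',
        (b (Sum.inl 0) : Module.End ℂ (ℂ ⊗[ℚ] V)) = gradingEnd e deg * X.baseChange ℂ * (1 - gradingEnd e deg) ∧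
        (b (Sum.inl 1) : Module.End ℂ (ℂ ⊗[ℚ] V)) = (1 - gradingEnd e deg) * X.baseChange ℂ * gradingEnd e deg ∧
        (b (Sum.inl 2) : Module.End ℂ (ℂ ⊗[ℚ] V)) = (2 : ℂ) • gradingEnd e deg - 1 ∧
        (∀ j, (b (Sum.inr j) : Module.End ℂ (ℂ ⊗[ℚ] V)) * gradingEnd e deg = gradingEnd e deg * b (Sum.inr j) ∧
          (b (Sum.inr j) : Module.End ℂ (ℂ ⊗[ℚ] V)) * (gradingEnd e deg * X.baseChange ℂ * (1 - gradingEnd e deg)) =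
            (gradingEnd e deg * X.baseChange ℂ * (1 - gradingEnd e deg)) * b (Sum.inr j)) ∧
        ∀ j, (b (Sum.inr j) : Module.End ℂ (ℂ ⊗[ℚ] V)) = (bk j : Module.End ℂ (ℂ ⊗[ℚ] V)) := by
  letI : LieRing (Module.End ℂ (ℂ ⊗[ℚ] V)) := LieRing.ofAssociativeRing
  intro 𝔏' h𝔏'
  classical
  obtain ⟨hE0, hF0⟩ := projE_ne_zero_of_not_mem_endAlg H hn e hF hFc hdeg hXE
  have hPP : gradingEnd e deg * gradingEnd e deg = gradingEnd e deg := gradingEnd_mul_gradingEnd_of_deg e hdeg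
  have hYM : X.baseChange ℂ ∈ H.hodgeLieC := H.baseChange_mem_hodgeLieC hX
  obtain ⟨hEM, hFM⟩ := projE_mem_hodgeLieC H e hF hFc hdeg hYM
  have hΘM : (2 : ℂ) • gradingEnd e deg - 1 ∈ H.hodgeLieC := by
    have h := two_smul_gradingEnd_sub_mem_hodgeLieC H e hF hFc
    have h1 : ((n : ℤ) : ℂ) • (1 : Module.End ℂ (ℂ ⊗[ℚ] V)) = 1 := by rw [hn, Int.cast_one, one_smul]
    rw [h1] at h
    exact h
  have hmem𝔏' : ∀ {Y}, Y ∈ H.hodgeLieC → Y ∈ 𝔏' := fun hY => by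
    rw [← LieSubalgebra.mem_toSubmodule, h𝔏']; exact hY
  set P := gradingEnd e deg with hP
  set E := P * X.baseChange ℂ * (1 - P) with hEdef
  set F := (1 - P) * X.baseChange ℂ * P with hFdef
  have hPE : P * E = E := by rw [hEdef, ← mul_assoc, ← mul_assoc, hPP]
  have hEP : E * P = 0 := by
    rw [hEdef, mul_assoc (P * X.baseChange ℂ) (1 - P) P, sub_mul, one_mul, hPP, sub_self, mul_zero]
  have hPF : P * F = 0 := by
    rw [hFdef, mul_assoc (1 - P) (X.baseChange ℂ) P, ← mul_assoc P (1 - P), mul_sub, mul_one, hPP, sub_self, zero_mul]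
  have hFP : F * P = F := by rw [hFdef, mul_assoc ((1 - P) * X.baseChange ℂ) P P, hPP]
  -- the centraliser `𝔨` and a basis of it
  set 𝔨 : Submodule ℂ (Module.End ℂ (ℂ ⊗[ℚ] V)) := H.hodgeLieC ⊓
    Module.End.eigenspace (LinearMap.mulLeft ℂ P - LinearMap.mulRight ℂ P) 0 ⊓
    Module.End.eigenspace (LinearMap.mulLeft ℂ E - LinearMap.mulRight ℂ E) 0 with h𝔨
  have hmem : ∀ Z, Z ∈ 𝔨 ↔ Z ∈ H.hodgeLieC ∧ Z * P = P * Z ∧ Z * E = E * Z := fun Z => by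
    rw [h𝔨, Submodule.mem_inf, Submodule.mem_inf, mem_eigenspace_adP_zero_iff, mem_eigenspace_adP_zero_iff]
    constructor
    · rintro ⟨⟨h1, h2⟩, h3⟩; exact ⟨h1, h2.symm, h3.symm⟩
    · rintro ⟨h1, h2, h3⟩; exact ⟨⟨h1, h2.symm⟩, h3.symm⟩
  intro m bk
  -- the family
  have hkmem : ∀ j, ((bk j : 𝔨) : Module.End ℂ (ℂ ⊗[ℚ] V)) ∈ 𝔏' := fun j => hmem𝔏' ((hmem _).1 (bk j).2).1
  let v : Fin 3 ⊕ Fin m → 𝔏' := Sum.elim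
    ![⟨E, hmem𝔏' hEM⟩, ⟨F, hmem𝔏' hFM⟩, ⟨(2 : ℂ) • P - 1, hmem𝔏' hΘM⟩]
    (fun j => ⟨((bk j : 𝔨) : Module.End ℂ (ℂ ⊗[ℚ] V)), hkmem j⟩)
  have hv0 : (v (Sum.inl 0) : Module.End ℂ (ℂ ⊗[ℚ] V)) = E := rfl
  have hv1 : (v (Sum.inl 1) : Module.End ℂ (ℂ ⊗[ℚ] V)) = F := rfl
  have hv2 : (v (Sum.inl 2) : Module.End ℂ (ℂ ⊗[ℚ] V)) = (2 : ℂ) • P - 1 := rfl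
  have hvr : ∀ j, (v (Sum.inr j) : Module.End ℂ (ℂ ⊗[ℚ] V)) = ((bk j : 𝔨) : Module.End ℂ (ℂ ⊗[ℚ] V)) := fun j => rfl
  -- a combination of the `k`-part lies in `𝔨`
  have hKmem : ∀ g : Fin m → ℂ, (∑ j, g j • ((bk j : 𝔨) : Module.End ℂ (ℂ ⊗[ℚ] V))) ∈ 𝔨 := fun g =>
    Submodule.sum_mem _ fun j _ => Submodule.smul_mem _ _ (bk j).2
  -- linear independence
  have hli : LinearIndependent ℂ v := by
    rw [Fintype.linearIndependent_iff]
    intro g hg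
    have hg' := congrArg (fun T : 𝔏' => (T : Module.End ℂ (ℂ ⊗[ℚ] V))) hg
    simp only [ZeroMemClass.coe_zero] at hg'
    rw [Fintype.sum_sum_type, Fin.sum_univ_three] at hg'
    simp only [AddMemClass.coe_add, SetLike.val_smul, hv0, hv1, hv2, hvr, AddSubmonoidClass.coe_finsetSum] at hg'
    obtain ⟨-, hKP, hKE⟩ := (hmem _).1 (hKmem fun j => g (Sum.inr j))
    obtain ⟨h0, h1, h2, hK⟩ :=
      eq_zero_of_combination_eq_zero hPP hPE hEP hPF hFP hE0 hF0 hKP hKE hg'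
    have hK' : (∑ j, g (Sum.inr j) • bk j : 𝔨) = 0 := by
      apply Subtype.ext
      rw [Submodule.coe_sum, Submodule.coe_zero, ← hK]
      exact Finset.sum_congr rfl fun j _ => by rw [Submodule.coe_smul]
    have hli' := bk.linearIndependent
    rw [Fintype.linearIndependent_iff] at hli'
    have hgr := hli' (fun j => g (Sum.inr j)) hK'
    intro i
    rcases i with i | j
    · fin_cases i
      · exact h0
      · exact h1
      · exact h2
    · exact hgr j
  -- spanning
  have hspan : ⊤ ≤ Submodule.span ℂ (Set.range v) := by
    rintro ⟨Y, hY⟩ -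
    have hYC : Y ∈ H.hodgeLieC := by rw [← h𝔏']; exact hY
    obtain ⟨c, c', d, Z, hZM, hZP, hZE, hYdec⟩ :=
      exists_decomposition_of_plusLine H hn e hF hFc hdeg hX hplus hminus hYC
    rw [← hP] at hZP hZE hYdec
    rw [← hEdef] at hZE hYdec
    rw [← hFdef] at hYdec
    have hZ𝔨 : Z ∈ 𝔨 := (hmem Z).2 ⟨hZM, hZP, hZE⟩
    -- `Z` is a combination of the `bk j`
    have hZsum : Z = ∑ j, (bk.repr ⟨Z, hZ𝔨⟩ j) • ((bk j : 𝔨) : Module.End ℂ (ℂ ⊗[ℚ] V)) := by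
      have h := congrArg (fun T : 𝔨 => (T : Module.End ℂ (ℂ ⊗[ℚ] V))) (bk.sum_repr ⟨Z, hZ𝔨⟩)
      simp only [Submodule.coe_sum, Submodule.coe_smul] at h
      exact h.symm
    have hYv : (⟨Y, hY⟩ : 𝔏') = c • v (Sum.inl 0) + c' • v (Sum.inl 1) + d • v (Sum.inl 2) +
        ∑ j, (bk.repr ⟨Z, hZ𝔨⟩ j) • v (Sum.inr j) := by
      apply Subtype.ext
      simp only [AddMemClass.coe_add, SetLike.val_smul, hv0, hv1, hv2, hvr, AddSubmonoidClass.coe_finsetSum]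
      rw [← hZsum]
      exact hYdec
    rw [hYv]
    refine Submodule.add_mem _ (Submodule.add_mem _ (Submodule.add_mem _ ?_ ?_) ?_) ?_
    · exact Submodule.smul_mem _ _ (Submodule.subset_span ⟨Sum.inl 0, rfl⟩)
    · exact Submodule.smul_mem _ _ (Submodule.subset_span ⟨Sum.inl 1, rfl⟩)
    · exact Submodule.smul_mem _ _ (Submodule.subset_span ⟨Sum.inl 2, rfl⟩)
    · exact Submodule.sum_mem _ fun j _ => Submodule.smul_mem _ _ (Submodule.subset_span ⟨Sum.inr j, rfl⟩)
  refine ⟨Module.Basis.mk hli hspan, ?_, ?_, ?_, fun j => ?_, fun j => ?_⟩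
  · rw [Module.Basis.mk_apply]; exact hv0
  · rw [Module.Basis.mk_apply]; exact hv1
  · rw [Module.Basis.mk_apply]; exact hv2
  · rw [Module.Basis.mk_apply, hvr]
    obtain ⟨-, hKP, hKE⟩ := (hmem _).1 (bk j).2
    exact ⟨hKP, hKE⟩
  · rw [Module.Basis.mk_apply, hvr]


/-- **An adapted basis of `𝔥_ℂ` in the plus-line position** (some basis of `𝔨` extended by `E, F, Θ`).
[cite: MoonenZarhin1999LowDim, §2 (2.3)] [cite: Deligne1982HodgeCycles, I §3 (proof of Prop. 3.4)] -/
theorem exists_basis_plusLine (H : HodgeStructure V n) (hn : n = 1)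
    (e : Module.Basis S ℂ (ℂ ⊗[ℚ] V)) (hF : ∀ a, H.F a = Submodule.span ℂ (e '' {σ | a ≤ deg σ}))
    (hFc : ∀ a, complexConj (H.F a) = Submodule.span ℂ (e '' {σ | deg σ ≤ n - a}))
    (hdeg : ∀ σ, deg σ = 0 ∨ deg σ = 1) {X : Module.End ℚ V} (hX : X ∈ H.hodgeLie) (hXE : X ∉ H.endAlg)
    (hplus : ∀ Y ∈ H.hodgeLieC, ∃ c : ℂ,
      gradingEnd e deg * Y * (1 - gradingEnd e deg) = c • (gradingEnd e deg * X.baseChange ℂ * (1 - gradingEnd e deg)))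
    (hminus : ∀ Y ∈ H.hodgeLieC, ∃ c : ℂ,
      (1 - gradingEnd e deg) * Y * gradingEnd e deg = c • ((1 - gradingEnd e deg) * X.baseChange ℂ * gradingEnd e deg)) :
    letI : LieRing (Module.End ℂ (ℂ ⊗[ℚ] V)) := LieRing.ofAssociativeRing
    ∀ (𝔏' : LieSubalgebra ℂ (Module.End ℂ (ℂ ⊗[ℚ] V))), 𝔏'.toSubmodule = H.hodgeLieC →
      ∃ (m : ℕ) (b : Module.Basis (Fin 3 ⊕ Fin m) ℂ 𝔏'),
        (b (Sum.inl 0) : Module.End ℂ (ℂ ⊗[ℚ] V)) = gradingEnd e deg * X.baseChange ℂ * (1 - gradingEnd e deg) ∧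
        (b (Sum.inl 1) : Module.End ℂ (ℂ ⊗[ℚ] V)) = (1 - gradingEnd e deg) * X.baseChange ℂ * gradingEnd e deg ∧
        (b (Sum.inl 2) : Module.End ℂ (ℂ ⊗[ℚ] V)) = (2 : ℂ) • gradingEnd e deg - 1 ∧
        ∀ j, (b (Sum.inr j) : Module.End ℂ (ℂ ⊗[ℚ] V)) * gradingEnd e deg = gradingEnd e deg * b (Sum.inr j) ∧
          (b (Sum.inr j) : Module.End ℂ (ℂ ⊗[ℚ] V)) * (gradingEnd e deg * X.baseChange ℂ * (1 - gradingEnd e deg)) =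
            (gradingEnd e deg * X.baseChange ℂ * (1 - gradingEnd e deg)) * b (Sum.inr j) := by
  letI : LieRing (Module.End ℂ (ℂ ⊗[ℚ] V)) := LieRing.ofAssociativeRing
  intro 𝔏' h𝔏'
  obtain ⟨b, h0, h1, h2, hbr, -⟩ :=
    exists_basis_plusLine_of_basis H hn e hF hFc hdeg hX hXE hplus hminus 𝔏' h𝔏' (Module.finBasis ℂ _)
  exact ⟨_, b, h0, h1, h2, hbr⟩

/-! ## §2 The column `κ_ℂ(·, E)` and `8 tr(· E)` agree (up to `dim V`) -/

-- many subtype coercions and an explicit `Fin 3 ⊕ Fin m`-indexed trace computation: above the default budget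
set_option maxHeartbeats 800000 in
/-- **`dim_ℚ V · κ_{𝔏'}(Y, E) = 8 · tr_{V_ℂ}(Y E)` for every `Y` in a Lie subalgebra `𝔏' ≤ 𝔤𝔩_ℂ(V_ℂ)` with carrier `𝔥_ℂ`**
(plus-line position, `𝔷 = 0`): on the adapted basis, `κ(F, E) = 4α` (ad-traces: `⁅F,⁅E,F⁆⁆ = 2αF`, `⁅F,⁅E,Θ⁆⁆ = 2αΘ`) and
`8 tr(F E) = 8α · dim V / 2`, while both vanish at `E`, `Θ` and on `𝔨`. [cite: MoonenZarhin1999LowDim, §2 (2.3)]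
[cite: Humphreys1972, §5.1 and §8.1] -/
theorem finrank_mul_killingForm_projE (H : HodgeStructure V n) (ψ : H.Polarization) (hn : n = 1)
    (e : Module.Basis S ℂ (ℂ ⊗[ℚ] V)) (hF : ∀ a, H.F a = Submodule.span ℂ (e '' {σ | a ≤ deg σ}))
    (hFc : ∀ a, complexConj (H.F a) = Submodule.span ℂ (e '' {σ | deg σ ≤ n - a}))
    (hdeg : ∀ σ, deg σ = 0 ∨ deg σ = 1) {X : Module.End ℚ V} (hX : X ∈ H.hodgeLie) (hXE : X ∉ H.endAlg)
    (hplus : ∀ Y ∈ H.hodgeLieC, ∃ c : ℂ,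
      gradingEnd e deg * Y * (1 - gradingEnd e deg) = c • (gradingEnd e deg * X.baseChange ℂ * (1 - gradingEnd e deg)))
    (hminus : ∀ Y ∈ H.hodgeLieC, ∃ c : ℂ,
      (1 - gradingEnd e deg) * Y * gradingEnd e deg = c • ((1 - gradingEnd e deg) * X.baseChange ℂ * gradingEnd e deg))
    (hz : H.hodgeLie ⊓ Subalgebra.toSubmodule H.endAlg = ⊥) :
    letI : LieRing (Module.End ℂ (ℂ ⊗[ℚ] V)) := LieRing.ofAssociativeRing
    ∀ (𝔏' : LieSubalgebra ℂ (Module.End ℂ (ℂ ⊗[ℚ] V))) (_h𝔏' : 𝔏'.toSubmodule = H.hodgeLieC) (E' : 𝔏')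
      (_hE' : (E' : Module.End ℂ (ℂ ⊗[ℚ] V)) = gradingEnd e deg * X.baseChange ℂ * (1 - gradingEnd e deg)) (Y : 𝔏'),
      (Module.finrank ℚ V : ℂ) * killingForm ℂ 𝔏' Y E' =
        8 * LinearMap.trace ℂ (ℂ ⊗[ℚ] V) ((Y : Module.End ℂ (ℂ ⊗[ℚ] V)) * E') := by
  letI : LieRing (Module.End ℂ (ℂ ⊗[ℚ] V)) := LieRing.ofAssociativeRing
  intro 𝔏' h𝔏' E' hE' Y
  classical
  obtain ⟨α, hα, hEF, hFE, -⟩ :=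
    projE_mul_projF_eq_smul_of_plusLine_of_center_eq_bot H ψ hn e hF hFc hdeg hX hXE hplus hminus hz
  obtain ⟨m, b, hb0, hb1, hb2, hbr⟩ := exists_basis_plusLine H hn e hF hFc hdeg hX hXE hplus hminus 𝔏' h𝔏'
  have hPP : gradingEnd e deg * gradingEnd e deg = gradingEnd e deg := gradingEnd_mul_gradingEnd_of_deg e hdeg
  set P := gradingEnd e deg with hP
  set E := P * X.baseChange ℂ * (1 - P) with hEdef
  set F := (1 - P) * X.baseChange ℂ * P with hFdef
  have hPE : P * E = E := by rw [hEdef, ← mul_assoc, ← mul_assoc, hPP]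
  have hEP : E * P = 0 := by
    rw [hEdef, mul_assoc (P * X.baseChange ℂ) (1 - P) P, sub_mul, one_mul, hPP, sub_self, mul_zero]
  have hPF : P * F = 0 := by
    rw [hFdef, mul_assoc (1 - P) (X.baseChange ℂ) P, ← mul_assoc P (1 - P), mul_sub, mul_one, hPP, sub_self, zero_mul]
  have hFP : F * P = F := by rw [hFdef, mul_assoc ((1 - P) * X.baseChange ℂ) P P, hPP]
  obtain ⟨hEE, -⟩ := SL2Triple.mul_self_eq_zero hPE hEP hPF hFP
  clear_value P E F
  obtain ⟨hΘE, hΘF⟩ := theta_bracket hPE hEP hPF hFP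
  have hE'E : E' = b (Sum.inl 0) := Subtype.ext (by rw [hE', hb0])
  -- brackets with `E` inside `𝔏'`
  have hbrE : ⁅E', b (Sum.inl 0)⁆ = 0 := by rw [← hE'E, lie_self]
  have hbrF : ⁅E', b (Sum.inl 1)⁆ = α • b (Sum.inl 2) := by
    apply Subtype.ext
    rw [LieSubalgebra.coe_bracket, LieRing.of_associative_ring_bracket, SetLike.val_smul, hE', hb1, hb2, hEF, hFE]
    module
  have hbrΘ : ⁅E', b (Sum.inl 2)⁆ = (-2 : ℂ) • b (Sum.inl 0) := by
    apply Subtype.ext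
    rw [LieSubalgebra.coe_bracket, LieRing.of_associative_ring_bracket, SetLike.val_smul, hE', hb2, hb0, ← neg_sub, hΘE,
      neg_smul]
  have hbrk : ∀ j, ⁅E', b (Sum.inr j)⁆ = 0 := fun j => by
    rw [← LieSubalgebra.coe_zero_iff_zero, LieSubalgebra.coe_bracket, LieRing.of_associative_ring_bracket, hE',
      ← (hbr j).2, sub_self]
  -- the Killing column: `κ(Y, E) = α [⁅Y,Θ⁆]_F − 2 [⁅Y,E⁆]_Θ`
  have hκ : ∀ Y : 𝔏', killingForm ℂ 𝔏' Y E' =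
      α * b.repr ⁅Y, b (Sum.inl 2)⁆ (Sum.inl 1) + (-2) * b.repr ⁅Y, b (Sum.inl 0)⁆ (Sum.inl 2) := by
    intro Y
    rw [killingForm_apply_apply, LinearMap.trace_eq_matrix_trace ℂ b, Matrix.trace, Fintype.sum_sum_type,
      Fin.sum_univ_three]
    simp only [Matrix.diag_apply, LinearMap.toMatrix_apply, LinearMap.comp_apply, LieAlgebra.ad_apply, hbrE, hbrF,
      hbrΘ, hbrk, map_zero, Finsupp.zero_apply, map_smul, Finsupp.smul_apply, smul_eq_mul,
      Finset.sum_const_zero, zero_add, add_zero]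
  -- traces: `2 tr P = dim V`
  have hd : 2 * LinearMap.trace ℂ (ℂ ⊗[ℚ] V) P = (Module.finrank ℚ V : ℂ) := by
    have h := (two_mul_trace_mul_proj (z := 1) hα hEF hFE (by rw [one_mul, mul_one])).1
    rw [one_mul, LinearMap.trace_one, Module.finrank_baseChange] at h
    exact h
  -- both sides are linear in `Y`; compare on the basis (no `rw` on scalar goals: `simp only` + `linear_combination`)
  suffices hbasis : ∀ i, (Module.finrank ℚ V : ℂ) * killingForm ℂ 𝔏' (b i) E' =
      8 * LinearMap.trace ℂ (ℂ ⊗[ℚ] V) ((b i : Module.End ℂ (ℂ ⊗[ℚ] V)) * E) by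
    have hY : Y = ∑ i, b.repr Y i • b i := (b.sum_repr Y).symm
    have h1 : killingForm ℂ 𝔏' Y E' = ∑ i, b.repr Y i * killingForm ℂ 𝔏' (b i) E' := by
      conv_lhs => rw [hY]
      simp only [LinearMap.map_sum₂, LinearMap.map_smul₂, smul_eq_mul]
    have h2 : LinearMap.trace ℂ (ℂ ⊗[ℚ] V) ((Y : Module.End ℂ (ℂ ⊗[ℚ] V)) * E) =
        ∑ i, b.repr Y i * LinearMap.trace ℂ (ℂ ⊗[ℚ] V) ((b i : Module.End ℂ (ℂ ⊗[ℚ] V)) * E) := by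
      conv_lhs => rw [hY]
      simp only [AddSubmonoidClass.coe_finsetSum, SetLike.val_smul, Finset.sum_mul, smul_mul_assoc, map_sum, map_smul,
        smul_eq_mul]
    simp only [hE', h1, h2, Finset.mul_sum]
    exact Finset.sum_congr rfl fun i _ => by linear_combination (b.repr Y i) * hbasis i
  intro i
  -- traces against `E`
  have htrΘ : LinearMap.trace ℂ (ℂ ⊗[ℚ] V) (((2 : ℂ) • P - 1) * E) = 0 := by
    have h := trace_mul_projE_mul_eq_zero (z := 1) (Z := (2 : ℂ) • P - 1) hPP hPE hEP (by rw [one_mul, mul_one])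
      (by rw [sub_mul, mul_sub, smul_mul_assoc, mul_smul_comm, hPP, one_mul, mul_one])
    rw [one_mul, LinearMap.trace_mul_comm] at h
    exact h
  have htrk : ∀ j, LinearMap.trace ℂ (ℂ ⊗[ℚ] V) ((b (Sum.inr j) : Module.End ℂ (ℂ ⊗[ℚ] V)) * E) = 0 := fun j => by
    have h := trace_mul_projE_mul_eq_zero (z := 1) (Z := (b (Sum.inr j) : Module.End ℂ (ℂ ⊗[ℚ] V))) hPP hPE hEP
      (by rw [one_mul, mul_one]) (hbr j).1
    rw [one_mul, LinearMap.trace_mul_comm] at h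
    exact h
  have htrF : LinearMap.trace ℂ (ℂ ⊗[ℚ] V) (F * E) = α * LinearMap.trace ℂ (ℂ ⊗[ℚ] V) P := by
    rw [LinearMap.trace_mul_comm, hEF, map_smul, smul_eq_mul]
  -- brackets among the first three basis vectors and with `𝔨`
  have hEΘ : ⁅b (Sum.inl 0), b (Sum.inl 2)⁆ = (-2 : ℂ) • b (Sum.inl 0) := by rw [← hE'E, hbrΘ, ← hE'E]
  have hFΘ : ⁅b (Sum.inl 1), b (Sum.inl 2)⁆ = (2 : ℂ) • b (Sum.inl 1) := by
    apply Subtype.ext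
    rw [LieSubalgebra.coe_bracket, LieRing.of_associative_ring_bracket, SetLike.val_smul, hb1, hb2, ← neg_sub, hΘF,
      neg_neg]
  have hFE' : ⁅b (Sum.inl 1), b (Sum.inl 0)⁆ = (-α) • b (Sum.inl 2) := by
    rw [← lie_skew, ← hE'E, hbrF, neg_smul]
  have hΘE' : ⁅b (Sum.inl 2), b (Sum.inl 0)⁆ = (2 : ℂ) • b (Sum.inl 0) := by
    rw [← lie_skew, ← hE'E, hbrΘ, ← hE'E, neg_smul, neg_neg]
  have hkΘ : ∀ j, ⁅b (Sum.inr j), b (Sum.inl 2)⁆ = 0 := fun j => by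
    rw [← LieSubalgebra.coe_zero_iff_zero, LieSubalgebra.coe_bracket, LieRing.of_associative_ring_bracket, hb2, mul_sub,
      sub_mul, mul_smul_comm, smul_mul_assoc, mul_one, one_mul, (hbr j).1, sub_self]
  have hkE : ∀ j, ⁅b (Sum.inr j), b (Sum.inl 0)⁆ = 0 := fun j => by
    rw [← LieSubalgebra.coe_zero_iff_zero, LieSubalgebra.coe_bracket, LieRing.of_associative_ring_bracket, hb0,
      (hbr j).2, sub_self]
  have h01 : (Sum.inl 0 : Fin 3 ⊕ Fin m) ≠ Sum.inl 1 := by simp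
  have h02 : (Sum.inl 0 : Fin 3 ⊕ Fin m) ≠ Sum.inl 2 := by simp
  rcases i with i | j
  · obtain rfl | rfl | rfl : i = 0 ∨ i = 1 ∨ i = 2 := by fin_cases i <;> simp
    · -- `Y = E`
      have hc1 : b.repr ⁅b (Sum.inl 0), b (Sum.inl 2)⁆ (Sum.inl 1) = 0 := by
        rw [hEΘ, map_smul, Finsupp.smul_apply, b.repr_self, Finsupp.single_eq_of_ne' h01, smul_zero]
      have hc2 : b.repr ⁅b (Sum.inl 0), b (Sum.inl 0)⁆ (Sum.inl 2) = 0 := by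
        rw [lie_self, map_zero, Finsupp.zero_apply]
      have htr : LinearMap.trace ℂ (ℂ ⊗[ℚ] V) ((b (Sum.inl 0) : Module.End ℂ (ℂ ⊗[ℚ] V)) * E) = 0 := by
        rw [hb0, hEE, map_zero]
      simp only [hκ, hc1, hc2, htr, mul_zero, add_zero]
    · -- `Y = F`: `κ(F,E) = 4α`, `tr(F E) = α dim V / 2`
      have hc1 : b.repr ⁅b (Sum.inl 1), b (Sum.inl 2)⁆ (Sum.inl 1) = 2 := by
        rw [hFΘ, map_smul, Finsupp.smul_apply, b.repr_self, Finsupp.single_eq_same, smul_eq_mul, mul_one]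
      have hc2 : b.repr ⁅b (Sum.inl 1), b (Sum.inl 0)⁆ (Sum.inl 2) = -α := by
        rw [hFE', map_smul, Finsupp.smul_apply, b.repr_self, Finsupp.single_eq_same, smul_eq_mul, mul_one]
      have htr : LinearMap.trace ℂ (ℂ ⊗[ℚ] V) ((b (Sum.inl 1) : Module.End ℂ (ℂ ⊗[ℚ] V)) * E) =
          α * LinearMap.trace ℂ (ℂ ⊗[ℚ] V) P := by rw [hb1, htrF]
      simp only [hκ, hc1, hc2, htr]
      linear_combination (-4 * α) * hd
    · -- `Y = Θ`
      have hc1 : b.repr ⁅b (Sum.inl 2), b (Sum.inl 2)⁆ (Sum.inl 1) = 0 := by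
        rw [lie_self, map_zero, Finsupp.zero_apply]
      have hc2 : b.repr ⁅b (Sum.inl 2), b (Sum.inl 0)⁆ (Sum.inl 2) = 0 := by
        rw [hΘE', map_smul, Finsupp.smul_apply, b.repr_self, Finsupp.single_eq_of_ne' h02, smul_zero]
      have htr : LinearMap.trace ℂ (ℂ ⊗[ℚ] V) ((b (Sum.inl 2) : Module.End ℂ (ℂ ⊗[ℚ] V)) * E) = 0 := by
        rw [hb2, htrΘ]
      simp only [hκ, hc1, hc2, htr, mul_zero, add_zero]
  · -- `Y = k_j`
    have hc1 : b.repr ⁅b (Sum.inr j), b (Sum.inl 2)⁆ (Sum.inl 1) = 0 := by rw [hkΘ, map_zero, Finsupp.zero_apply]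
    have hc2 : b.repr ⁅b (Sum.inr j), b (Sum.inl 0)⁆ (Sum.inl 2) = 0 := by rw [hkE, map_zero, Finsupp.zero_apply]
    simp only [hκ, hc1, hc2, htrk j, mul_zero, add_zero]

end HodgeStructure

end Literature.AlgebraicGeometry.Motives

end
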